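import Literature.Probability.LatticeModels.ShiftLemmaGeometry
import Literature.Probability.LatticeModels.IsingFiniteEnergy
import HarnessLib

/-!
# The shift lemma (Georgii–Higuchi 2000, Lemma 3.4) for tail-trivial Gibbs measures

Topic `Probability/LatticeModels`. Georgii–Higuchi 2000, Lemma 3.4 (p. 1157): "*Shift lemma.*
Consider a half-plane `π` and the associated "shrinked" half-plane `π̃`; `μ(E⁺_π) = 1` if and only
if `μ(E⁺_{π̃}) = 1`." We prove the non-trivial direction for the upper half-plane `π_up = {x₂ ≥ 0}`,
`π̃ = {x₂ ≥ 1}`, and tail-trivial `μ ∈ 𝒢` (the case used in §5–6), in contrapositive form: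
if `μ(E⁺_{π̃}) = 0` then `μ(E⁺_up) = 0`.

Proof (GH, made circuit-free). Suppose no infinite `+`cluster in `π̃`. For `n ≥ 1` let `F_n` be
the lattice cluster of the corner `(-n, 1)` in "`W_n ∪ {+ sites of π̃}`", `W_n = [-n, n] × [1, n+1]`
(GH: "the smallest `-∗`semicircuit `σ_n` in `π̃` containing `Λ_n`" is the boundary of `F_n`);
`F_n` is a.s. finite. Its two *facing axis sites* `x_n = (a_n, 0)`, `y_n = (b_n, 0)` are
determined by `F_n`, i.e. by the spins in `π̃`. By `ShiftLemmaGeometry`, if the spins at `x_n, y_n`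
are `-1` then `[-n, n] × [0, n + 1]` meets no infinite `+`cluster of `π_up`. By finite energy
(`IsGibbsMeasure.mul_measure_glueWith_preimage_le`, GH Lemma 3.4 proof: "`μ(A_N ∩ B_{N,x,y}) ≥
δ² μ(B_{N,x,y})`"), summed over the values `(x, y)` of `(x_n, y_n)`, this event has probability
`≥ δ > 0` for every `n`; letting `n → ∞`, `μ(π_up has no infinite +cluster) ≥ δ`, and tail
triviality gives `μ(E⁺_up) = 0`. (GH iterate the finite-energy bound along `n` using the pairwise
disjointness of `{x_n, y_n}`; for tail-trivial `μ` one application suffices.)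

Main results: `le_measure_windowGood` (the finite-energy bound), **`shift_lemma_up`** (level `0 → 1`,
any sign `s`) and **`shift_lemma_up_level`** (all levels, by iterating along vertical translates of
`μ`).

## References

* H.-O. Georgii, Y. Higuchi, *Percolation and number of phases in the two-dimensional Ising
  model*, J. Math. Phys. 41 (2000), Lemma 3.4 [GeorgiiHiguchi2000].
-/

noncomputable section

open MeasureTheory Filter SimpleGraph Finset
open Literature.Probability.Percolation
open scoped ENNReal

namespace Literature.Probability.LatticeModels

/-! ### Signs -/

/-- **An opposite-sign `∗`semicircuit of `π_up` around a box kills the `s`-clusters of the box**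
(sign-symmetric form of `siteCluster_finite_of_minusStarWalk`). [cite: GeorgiiHiguchi2000, Lemma 3.4 (proof)] -/
theorem siteCluster_finite_of_oppStarWalk {ω : SpinConfig (Site 2)} {s : ℤˣ} {n : ℕ} {a b : ℤ}
    (ha : a < -(n : ℤ)) (hb : (n : ℤ) < b)
    (α : zdStarGraph.Walk (![a, 0] : Site 2) ![b, 0])
    (hα : ∀ z ∈ α.support, 0 ≤ z 1 ∧ ω z = -s ∧ ¬ (-(n : ℤ) ≤ z 0 ∧ z 0 ≤ n ∧ z 1 ≤ (n : ℤ) + 1))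
    {u : Site 2} (hu : -(n : ℤ) ≤ u 0 ∧ u 0 ≤ n ∧ 0 ≤ u 1 ∧ u 1 ≤ (n : ℤ) + 1) :
    (siteCluster (zdGraph 2) (spinSites s ω ∩ halfPlane 0) u).Finite := by
  classical
  have hne : (-s : ℤˣ) ≠ s := by rcases Int.units_eq_one_or s with rfl | rfl <;> decide
  by_contra hinf
  rw [Set.not_finite] at hinf
  obtain ⟨α', hα'⟩ := exists_reflected_starWalk α
  have hcast : ((n + 1 : ℕ) : ℤ) = (n : ℤ) + 1 := by push_cast; ring
  obtain ⟨H, hH⟩ := (eventually_subset_box_holds (d := 2) (α.support.toFinset ∪ α'.support.toFinset)).exists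
  obtain ⟨w, hw, hwH⟩ := hinf.exists_notMem_finset (box 2 H)
  have huO : u ∈ spinSites s ω ∩ halfPlane 0 := hw.1
  have hu_mem : u ∈ siteCluster (zdGraph 2) (spinSites s ω ∩ halfPlane 0) u :=
    (mem_siteCluster_self_iff _ _ _).2 huO
  obtain ⟨β, hβ⟩ := exists_walk_of_mem_siteCluster hu_mem hw
  obtain ⟨z, hzβ, hz⟩ := exists_mem_support_of_bandSemicircuits (m := n + 1) (c₁ := -(n : ℤ)) (c₂ := n)
    ha hb (xL := ![a, 0]) (xR := ![b, 0]) (by simp) (by simp) (by simp) (by simp)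
    α (fun z hz h => (hα z hz).2.2 (by rw [hcast] at h; exact h))
    α' (fun z hz h => by
      have h' := (hα _ ((hα' z).1 hz)).2.2
      have hR0 : (reflectCoord (d := 2) 1 z) 0 = z 0 := Rf_apply_zero z
      have hR1 : (reflectCoord (d := 2) 1 z) 1 = -z 1 := Rf_apply_one z
      rw [hR0, hR1] at h'
      rw [hcast] at h
      exact h' ⟨h.1, h.2.1, by linarith [h.2.2]⟩)
    (H := H) (fun z hz => hH (Finset.mem_union_left _ (List.mem_toFinset.2 hz)))
    (fun z hz => hH (Finset.mem_union_right _ (List.mem_toFinset.2 hz)))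
    (u := u) (w := w) ⟨hu.1, hu.2.1, by rw [hcast]; linarith [hu.2.2.1], by rw [hcast]; exact hu.2.2.2⟩ hwH β
  have hzO := hβ z hzβ
  rcases hz with hz | hz
  · have := (hα z hz).2.1
    rw [hzO.1] at this
    exact hne this.symm
  · have hz' := hα _ ((hα' z).1 hz)
    have hR1 : (reflectCoord (d := 2) 1 z) 1 = -z 1 := Rf_apply_one z
    have hz0 : z 1 = 0 := by
      have h1 := hz'.1
      have h2 : 0 ≤ z 1 := hzO.2
      rw [hR1] at h1
      omega
    have hRz : reflectCoord (d := 2) 1 z = z := reflectCoord_one_eq_self_of_apply_one hz0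
    rw [hRz] at hz'
    have := hz'.2.1
    rw [hzO.1] at this
    exact hne this.symm

/-! ### The `+`hull of the window and its facing axis sites -/

section Hull

variable {n : ℕ}

/-- The window `W_n = [-n, n] × [1, n + 1]` is joined inside itself to its corner `(-n, 1)`. [folklore] -/
theorem mem_siteCluster_corner_of_window {O : Set (Site 2)}
    (hO : ∀ z : Site 2, (-(n : ℤ) ≤ z 0 ∧ z 0 ≤ n ∧ 1 ≤ z 1 ∧ z 1 ≤ (n : ℤ) + 1) → z ∈ O)
    {z : Site 2} (hz : -(n : ℤ) ≤ z 0 ∧ z 0 ≤ n ∧ 1 ≤ z 1 ∧ z 1 ≤ (n : ℤ) + 1) :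
    z ∈ siteCluster (zdGraph 2) O ![-(n : ℤ), 1] := by
  have hc₀ : (![-(n : ℤ), 1] : Site 2) ∈ siteCluster (zdGraph 2) O ![-(n : ℤ), 1] :=
    (mem_siteCluster_self_iff _ _ _).2 (hO _ ⟨by simp, by simp, by simp, by simp⟩)
  -- right run to `(z 0, 1)`
  set k₁ : ℕ := (z 0 + n).toNat with hk₁
  set run₁ := Zhang.stepRun (Pi.single 0 1) Zhang.adj_add_unitStep.1 (![-(n : ℤ), 1]) k₁ with hrun₁def
  have hend₁ : ((fun w : Site 2 => w + Pi.single 0 1)^[k₁] (![-(n : ℤ), 1] : Site 2)) = ![z 0, 1] := by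
    rw [Site.eq_iff_two, Zhang.iterate_add_apply, Zhang.iterate_add_apply]; simp; omega
  have hrun₁ : ∀ v ∈ run₁.support, v ∈ O := by
    intro v hv
    obtain ⟨j, hj, hj0, hj1⟩ := Zhang.mem_support_stepRun.1 hv
    simp at hj0 hj1
    have : (j : ℤ) ≤ k₁ := by exact_mod_cast hj
    exact hO v ⟨by omega, by omega, by omega, by omega⟩
  have hmid : (![z 0, 1] : Site 2) ∈ siteCluster (zdGraph 2) O ![-(n : ℤ), 1] :=
    mem_siteCluster_of_walk hc₀ (run₁.copy rfl hend₁) (by rw [Walk.support_copy]; exact hrun₁)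
  -- up run to `z`
  set k₂ : ℕ := (z 1 - 1).toNat with hk₂
  set run₂ := Zhang.stepRun (Pi.single 1 1) Zhang.adj_add_unitStep.2.2.1 (![z 0, 1]) k₂ with hrun₂def
  have hend₂ : ((fun w : Site 2 => w + Pi.single 1 1)^[k₂] (![z 0, 1] : Site 2)) = z := by
    rw [Site.eq_iff_two, Zhang.iterate_add_apply, Zhang.iterate_add_apply]; simp; omega
  have hrun₂ : ∀ v ∈ run₂.support, v ∈ O := by
    intro v hv
    obtain ⟨j, hj, hj0, hj1⟩ := Zhang.mem_support_stepRun.1 hv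
    simp at hj0 hj1
    have : (j : ℤ) ≤ k₂ := by exact_mod_cast hj
    exact hO v ⟨by omega, by omega, by omega, by omega⟩
  exact mem_siteCluster_of_walk hmid (run₂.copy rfl hend₂) (by rw [Walk.support_copy]; exact hrun₂)

/-- Sites of the hull outside the window lie in the `P`-cluster of a site near the window
(used for the a.s. finiteness of the hull). [folklore] -/
theorem exists_mem_siteCluster_of_mem_hull {O P : Set (Site 2)}
    (hOP : ∀ z ∈ O, (-(n : ℤ) ≤ z 0 ∧ z 0 ≤ n ∧ 1 ≤ z 1 ∧ z 1 ≤ (n : ℤ) + 1) ∨ z ∈ P)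
    {z : Site 2} (hz : z ∈ siteCluster (zdGraph 2) O ![-(n : ℤ), 1])
    (hzw : ¬ (-(n : ℤ) ≤ z 0 ∧ z 0 ≤ n ∧ 1 ≤ z 1 ∧ z 1 ≤ (n : ℤ) + 1)) :
    ∃ p ∈ box 2 (n + 2), z ∈ siteCluster (zdGraph 2) P p := by
  have hc₀ : (![-(n : ℤ), 1] : Site 2) ∈ siteCluster (zdGraph 2) O ![-(n : ℤ), 1] :=
    (mem_siteCluster_self_iff _ _ _).2 hz.1
  obtain ⟨q, hq⟩ := exists_walk_of_mem_siteCluster hz hc₀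
  obtain ⟨p, g, W₀, hpg, hg, -, hW₀S, hW₀q⟩ := exists_split_first_mem'
    (S := {v : Site 2 | -(n : ℤ) ≤ v 0 ∧ v 0 ≤ n ∧ 1 ≤ v 1 ∧ v 1 ≤ (n : ℤ) + 1}) q hzw
    ⟨_, Walk.end_mem_support q, show (-(n : ℤ) ≤ (![-(n : ℤ), 1] : Site 2) 0 ∧ _) by simp⟩
  have hg' : -(n : ℤ) ≤ g 0 ∧ g 0 ≤ n ∧ 1 ≤ g 1 ∧ g 1 ≤ (n : ℤ) + 1 := hg
  refine ⟨p, ?_, ?_⟩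
  · rw [mem_box, Fin.forall_fin_two]; push_cast
    rcases (zdGraph_two_adj_iff p g).1 hpg with ⟨h0, h1⟩ | ⟨h0, h1⟩ | ⟨h1, h0⟩ | ⟨h1, h0⟩ <;> omega
  · have hW₀P : ∀ v ∈ W₀.support, v ∈ P := fun v hv =>
      (hOP v (hq v (hW₀q v hv))).resolve_left (hW₀S v hv)
    have hzP : z ∈ siteCluster (zdGraph 2) P z :=
      (mem_siteCluster_self_iff _ _ _).2 (hW₀P z (Walk.start_mem_support W₀))
    have hpz : p ∈ siteCluster (zdGraph 2) P z := mem_siteCluster_of_walk hzP W₀ hW₀P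
    have hpp : p ∈ siteCluster (zdGraph 2) P p :=
      (mem_siteCluster_self_iff _ _ _).2 (hW₀P p (Walk.end_mem_support W₀))
    rw [← siteCluster_eq_of_mem hpz hpp]; exact hzP

/-- Existence of the left facing abscissa of a finite set near `ℓ₁`. [folklore] -/
theorem exists_leftFacing (F : Finset (Site 2)) (hne : ∃ t : ℤ, (![t + 1, 1] : Site 2) ∈ F ∨ (![t, 2] : Site 2) ∈ F) :
    ∃ a : ℤ, (∀ t ≤ a, (![t, 1] : Site 2) ∉ F) ∧ (∀ t < a, (![t, 2] : Site 2) ∉ F) ∧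
      ((![a + 1, 1] : Site 2) ∈ F ∨ (![a, 2] : Site 2) ∈ F) := by
  classical
  obtain ⟨B, hB⟩ := (eventually_subset_box_holds (d := 2) F).exists
  have hbdd : ∀ t : ℤ, ((![t + 1, 1] : Site 2) ∈ F ∨ (![t, 2] : Site 2) ∈ F) → -(B : ℤ) - 1 ≤ t := by
    rintro t (h | h) <;> have := hB h <;> rw [mem_box, Fin.forall_fin_two] at this <;> simp at this <;> omega
  obtain ⟨a, ha, hmin⟩ := Int.exists_least_of_bdd ⟨-(B : ℤ) - 1, hbdd⟩ hne
  refine ⟨a, fun t ht h => ?_, fun t ht h => ?_, ha⟩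
  · have := hmin (t - 1) (Or.inl (by rw [sub_add_cancel]; exact h)); omega
  · have := hmin t (Or.inr h); omega

/-- Existence of the right facing abscissa of a finite set near `ℓ₁`. [folklore] -/
theorem exists_rightFacing (F : Finset (Site 2)) (hne : ∃ t : ℤ, (![t - 1, 1] : Site 2) ∈ F ∨ (![t, 2] : Site 2) ∈ F) :
    ∃ b : ℤ, (∀ t, b ≤ t → (![t, 1] : Site 2) ∉ F) ∧ (∀ t, b < t → (![t, 2] : Site 2) ∉ F) ∧
      ((![b - 1, 1] : Site 2) ∈ F ∨ (![b, 2] : Site 2) ∈ F) := by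
  classical
  obtain ⟨B, hB⟩ := (eventually_subset_box_holds (d := 2) F).exists
  have hbdd : ∀ t : ℤ, ((![t - 1, 1] : Site 2) ∈ F ∨ (![t, 2] : Site 2) ∈ F) → t ≤ (B : ℤ) + 1 := by
    rintro t (h | h) <;> have := hB h <;> rw [mem_box, Fin.forall_fin_two] at this <;> simp at this <;> omega
  obtain ⟨b, hb, hmax⟩ := Int.exists_greatest_of_bdd ⟨(B : ℤ) + 1, hbdd⟩ hne
  refine ⟨b, fun t ht h => ?_, fun t ht h => ?_, hb⟩
  · have := hmax (t + 1) (Or.inl (by rw [add_sub_cancel_right]; exact h)); omega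
  · have := hmax t (Or.inr h); omega

/-- Uniqueness of the left facing abscissa. [folklore] -/
theorem leftFacing_unique {F : Set (Site 2)} {a a' : ℤ}
    (h0 : ∀ t ≤ a, (![t, 1] : Site 2) ∉ F) (h1 : ∀ t < a, (![t, 2] : Site 2) ∉ F)
    (h2 : (![a + 1, 1] : Site 2) ∈ F ∨ (![a, 2] : Site 2) ∈ F)
    (h0' : ∀ t ≤ a', (![t, 1] : Site 2) ∉ F) (h1' : ∀ t < a', (![t, 2] : Site 2) ∉ F)
    (h2' : (![a' + 1, 1] : Site 2) ∈ F ∨ (![a', 2] : Site 2) ∈ F) : a = a' := by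
  by_contra hne
  rcases lt_or_gt_of_ne hne with hlt | hlt
  · rcases h2 with h | h
    · exact h0' (a + 1) (by omega) h
    · exact h1' a hlt h
  · rcases h2' with h | h
    · exact h0 (a' + 1) (by omega) h
    · exact h1 a' hlt h

/-- Uniqueness of the right facing abscissa. [folklore] -/
theorem rightFacing_unique {F : Set (Site 2)} {b b' : ℤ}
    (h0 : ∀ t, b ≤ t → (![t, 1] : Site 2) ∉ F) (h1 : ∀ t, b < t → (![t, 2] : Site 2) ∉ F)
    (h2 : (![b - 1, 1] : Site 2) ∈ F ∨ (![b, 2] : Site 2) ∈ F)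
    (h0' : ∀ t, b' ≤ t → (![t, 1] : Site 2) ∉ F) (h1' : ∀ t, b' < t → (![t, 2] : Site 2) ∉ F)
    (h2' : (![b' - 1, 1] : Site 2) ∈ F ∨ (![b', 2] : Site 2) ∈ F) : b = b' := by
  by_contra hne
  rcases lt_or_gt_of_ne hne with hlt | hlt
  · rcases h2' with h | h
    · exact h0 (b' - 1) (by omega) h
    · exact h1 b' hlt h
  · rcases h2 with h | h
    · exact h0' (b - 1) (by omega) h
    · exact h1' b hlt h

end Hull

/-! ### Measurability -/

section Meas

/-- `ω ↦ S^s(ω) ∩ P` is measurable. [folklore] -/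
theorem measurable_spinSites_inter (s : ℤˣ) (P : Set (Site 2)) :
    Measurable fun ω : SpinConfig (Site 2) => spinSites s ω ∩ P := by
  have h := measurable_spinSites_inter_diff (V := Site 2) s P ∅
  simp only [Finset.coe_empty, Set.sdiff_empty] at h
  exact h.mono cylinderEvents_le_pi le_rfl

/-- The event "the `s`-cluster of `P` through `p` is infinite" is measurable. [folklore] -/
theorem measurableSet_infinite_spinCluster (s : ℤˣ) (P : Set (Site 2)) (p : Site 2) :
    MeasurableSet {ω : SpinConfig (Site 2) | (siteCluster (zdGraph 2) (spinSites s ω ∩ P) p).Infinite} := by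
  classical
  exact measurable_spinSites_inter s P (measurableSet_sitePercolatesAt (G := zdGraph 2) p)

/-- The random set "`W_n ∪ {+ sites of π̃}`" is a measurable function of the configuration. [folklore] -/
theorem measurable_windowOcc (s : ℤˣ) (n : ℕ) :
    Measurable fun ω : SpinConfig (Site 2) =>
      ({z : Site 2 | (-(n : ℤ) ≤ z 0 ∧ z 0 ≤ n ∧ 1 ≤ z 1 ∧ z 1 ≤ (n : ℤ) + 1) ∨ (ω z = s ∧ 1 ≤ z 1)} : Set (Site 2)) := by
  refine measurable_set_iff.2 fun a => ?_
  show Measurable fun ω : SpinConfig (Site 2) => (-(n : ℤ) ≤ a 0 ∧ a 0 ≤ n ∧ 1 ≤ a 1 ∧ a 1 ≤ (n : ℤ) + 1) ∨ (ω a = s ∧ 1 ≤ a 1)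
  refine Measurable.or measurable_const (Measurable.and ?_ measurable_const)
  have h1 : MeasurableSet {ω : SpinConfig (Site 2) | ω a = s} :=
    measurableSet_of_forall_eq_config (K := {a}) fun ω ω' h => by
      rw [Set.mem_setOf_eq, Set.mem_setOf_eq, h a (Finset.mem_singleton_self a)]
  exact measurableSet_setOf.1 h1

/-- Membership of a fixed site in the hull `F_n(ω)` is a measurable event. [folklore] -/
theorem measurableSet_mem_hull (s : ℤˣ) (n : ℕ) (z : Site 2) :
    MeasurableSet {ω : SpinConfig (Site 2) | z ∈ siteCluster (zdGraph 2)
      {v : Site 2 | (-(n : ℤ) ≤ v 0 ∧ v 0 ≤ n ∧ 1 ≤ v 1 ∧ v 1 ≤ (n : ℤ) + 1) ∨ (ω v = s ∧ 1 ≤ v 1)} ![-(n : ℤ), 1]} := by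
  classical
  exact (measurable_windowOcc s n) (measurableSet_mem_siteCluster (G := zdGraph 2) (![-(n : ℤ), 1]) z)

end Meas

/-! ### The deterministic step: `-`spins at the facing sites kill the `+`clusters of the box -/

section Good

variable {ω : SpinConfig (Site 2)} {n : ℕ}

/-- The hull `F_n(ω)` depends only on the spins in `π̃ = {x₂ ≥ 1}`. [folklore] -/
theorem hull_eq_of_eqOn_upper {ω ω' : SpinConfig (Site 2)} (s : ℤˣ) (n : ℕ) (h : ∀ v : Site 2, 1 ≤ v 1 → ω v = ω' v) :
    siteCluster (zdGraph 2) {v : Site 2 | (-(n : ℤ) ≤ v 0 ∧ v 0 ≤ n ∧ 1 ≤ v 1 ∧ v 1 ≤ (n : ℤ) + 1) ∨ (ω v = s ∧ 1 ≤ v 1)}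
        ![-(n : ℤ), 1] =
      siteCluster (zdGraph 2) {v : Site 2 | (-(n : ℤ) ≤ v 0 ∧ v 0 ≤ n ∧ 1 ≤ v 1 ∧ v 1 ≤ (n : ℤ) + 1) ∨ (ω' v = s ∧ 1 ≤ v 1)}
        ![-(n : ℤ), 1] := by
  have : {v : Site 2 | (-(n : ℤ) ≤ v 0 ∧ v 0 ≤ n ∧ 1 ≤ v 1 ∧ v 1 ≤ (n : ℤ) + 1) ∨ (ω v = s ∧ 1 ≤ v 1)} =
      {v : Site 2 | (-(n : ℤ) ≤ v 0 ∧ v 0 ≤ n ∧ 1 ≤ v 1 ∧ v 1 ≤ (n : ℤ) + 1) ∨ (ω' v = s ∧ 1 ≤ v 1)} := by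
    ext v
    simp only [Set.mem_setOf_eq]
    constructor
    · rintro (hw | ⟨hv, hv1⟩)
      · exact Or.inl hw
      · exact Or.inr ⟨by rw [← h v hv1]; exact hv, hv1⟩
    · rintro (hw | ⟨hv, hv1⟩)
      · exact Or.inl hw
      · exact Or.inr ⟨by rw [h v hv1]; exact hv, hv1⟩
  rw [this]

/-- **`-`spins at the two facing sites kill the `+`clusters of the box** (Georgii–Higuchi 2000,
proof of Lemma 3.4: "if `A_n` occurs then `[-n, n] × [0, n-1]` is surrounded by a `-∗`semicircuit
in `π_up` … `μ(E⁺_up) = 0`"): if the hull `F_n(ω)` is finite with facing abscissae `a, b` and the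
spins at `(a, 0)`, `(b, 0)` are `-1`, then every `+`cluster of `π_up` through `[-n, n] × [0, n+1]`
is finite. [cite: GeorgiiHiguchi2000, Lemma 3.4 (proof)] -/
theorem siteCluster_finite_of_facing {s : ℤˣ} {a b : ℤ}
    (hfin : (siteCluster (zdGraph 2) {v : Site 2 | (-(n : ℤ) ≤ v 0 ∧ v 0 ≤ n ∧ 1 ≤ v 1 ∧ v 1 ≤ (n : ℤ) + 1) ∨
      (ω v = s ∧ 1 ≤ v 1)} ![-(n : ℤ), 1]).Finite)
    (ha0 : ∀ t ≤ a, (![t, 1] : Site 2) ∉ siteCluster (zdGraph 2) {v : Site 2 | (-(n : ℤ) ≤ v 0 ∧ v 0 ≤ n ∧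
      1 ≤ v 1 ∧ v 1 ≤ (n : ℤ) + 1) ∨ (ω v = s ∧ 1 ≤ v 1)} ![-(n : ℤ), 1])
    (ha1 : ∀ t < a, (![t, 2] : Site 2) ∉ siteCluster (zdGraph 2) {v : Site 2 | (-(n : ℤ) ≤ v 0 ∧ v 0 ≤ n ∧
      1 ≤ v 1 ∧ v 1 ≤ (n : ℤ) + 1) ∨ (ω v = s ∧ 1 ≤ v 1)} ![-(n : ℤ), 1])
    (ha2 : (![a + 1, 1] : Site 2) ∈ siteCluster (zdGraph 2) {v : Site 2 | (-(n : ℤ) ≤ v 0 ∧ v 0 ≤ n ∧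
      1 ≤ v 1 ∧ v 1 ≤ (n : ℤ) + 1) ∨ (ω v = s ∧ 1 ≤ v 1)} ![-(n : ℤ), 1] ∨
      (![a, 2] : Site 2) ∈ siteCluster (zdGraph 2) {v : Site 2 | (-(n : ℤ) ≤ v 0 ∧ v 0 ≤ n ∧
      1 ≤ v 1 ∧ v 1 ≤ (n : ℤ) + 1) ∨ (ω v = s ∧ 1 ≤ v 1)} ![-(n : ℤ), 1])
    (hb0 : ∀ t, b ≤ t → (![t, 1] : Site 2) ∉ siteCluster (zdGraph 2) {v : Site 2 | (-(n : ℤ) ≤ v 0 ∧ v 0 ≤ n ∧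
      1 ≤ v 1 ∧ v 1 ≤ (n : ℤ) + 1) ∨ (ω v = s ∧ 1 ≤ v 1)} ![-(n : ℤ), 1])
    (hb1 : ∀ t, b < t → (![t, 2] : Site 2) ∉ siteCluster (zdGraph 2) {v : Site 2 | (-(n : ℤ) ≤ v 0 ∧ v 0 ≤ n ∧
      1 ≤ v 1 ∧ v 1 ≤ (n : ℤ) + 1) ∨ (ω v = s ∧ 1 ≤ v 1)} ![-(n : ℤ), 1])
    (hb2 : (![b - 1, 1] : Site 2) ∈ siteCluster (zdGraph 2) {v : Site 2 | (-(n : ℤ) ≤ v 0 ∧ v 0 ≤ n ∧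
      1 ≤ v 1 ∧ v 1 ≤ (n : ℤ) + 1) ∨ (ω v = s ∧ 1 ≤ v 1)} ![-(n : ℤ), 1] ∨
      (![b, 2] : Site 2) ∈ siteCluster (zdGraph 2) {v : Site 2 | (-(n : ℤ) ≤ v 0 ∧ v 0 ≤ n ∧
      1 ≤ v 1 ∧ v 1 ≤ (n : ℤ) + 1) ∨ (ω v = s ∧ 1 ≤ v 1)} ![-(n : ℤ), 1])
    (hxa : ω ![a, 0] = -s) (hyb : ω ![b, 0] = -s)
    {u : Site 2} (hu : -(n : ℤ) ≤ u 0 ∧ u 0 ≤ n ∧ 0 ≤ u 1 ∧ u 1 ≤ (n : ℤ) + 1) :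
    (siteCluster (zdGraph 2) (spinSites s ω ∩ halfPlane 0) u).Finite := by
  classical
  set Occ : Set (Site 2) := {v : Site 2 | (-(n : ℤ) ≤ v 0 ∧ v 0 ≤ n ∧ 1 ≤ v 1 ∧ v 1 ≤ (n : ℤ) + 1) ∨
    (ω v = s ∧ 1 ≤ v 1)} with hOcc
  set Hl := siteCluster (zdGraph 2) Occ ![-(n : ℤ), 1] with hHl
  have hwin : ∀ z : Site 2, (-(n : ℤ) ≤ z 0 ∧ z 0 ≤ n ∧ 1 ≤ z 1 ∧ z 1 ≤ (n : ℤ) + 1) → z ∈ Hl :=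
    fun z hz => mem_siteCluster_corner_of_window (fun v hv => Or.inl hv) hz
  have hHlH : ∀ z ∈ Hl, 1 ≤ z 1 := by
    intro z hz
    rcases mem_of_mem_siteCluster hz with h | h
    · exact h.2.2.1
    · exact h.2
  set F := hfin.toFinset with hF
  have hmemF : ∀ z, z ∈ F ↔ z ∈ Hl := fun z => Set.Finite.mem_toFinset hfin
  have han : a < -(n : ℤ) := by
    by_contra hle
    exact ha0 (-(n : ℤ)) (by omega) (hwin _ ⟨by simp, by simp, by simp, by simp⟩)
  have hbn : (n : ℤ) < b := by
    by_contra hle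
    exact hb0 (n : ℤ) (by omega) (hwin _ ⟨by simp, by simp, by simp, by simp⟩)
  obtain ⟨q, hq⟩ := exists_starWalk_boundary_level_one F {v | ω v = -s}
    (fun z hz => hHlH z ((hmemF z).1 hz))
    ⟨![-(n : ℤ), 1], (hmemF _).2 (hwin _ ⟨by simp, by simp, by simp, by simp⟩), by simp⟩
    (by
      intro u hu v hv
      obtain ⟨p, hp⟩ := exists_walk_of_mem_siteCluster ((hmemF u).1 hu) ((hmemF v).1 hv)
      exact ⟨p, fun z hz => (hmemF z).2 (mem_siteCluster_of_mem_support ((hmemF u).1 hu) p hp hz)⟩)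
    (by
      rintro v hv1 hvF ⟨c, hc, hvc⟩
      rcases units_eq_or_eq_neg s (ω v) with h | h
      · exact absurd ((hmemF v).2 (mem_siteCluster_of_adj ((hmemF c).1 hc) (Or.inr ⟨h, hv1⟩) hvc.symm)) hvF
      · exact h)
    (a := a) (b := b)
    (fun t ht h => ha0 t ht ((hmemF _).1 h)) (fun t ht h => ha1 t ht ((hmemF _).1 h))
    (by
      rcases ha2 with h | h
      · exact ⟨_, (hmemF _).2 h, by rw [zdGraph_two_adj_iff]; simp⟩
      · exact ⟨_, (hmemF _).2 h, by rw [zdGraph_two_adj_iff]; simp⟩)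
    (fun t ht h => hb0 t ht ((hmemF _).1 h)) (fun t ht h => hb1 t ht ((hmemF _).1 h))
    (by
      rcases hb2 with h | h
      · exact ⟨_, (hmemF _).2 h, by rw [zdGraph_two_adj_iff]; simp⟩
      · exact ⟨_, (hmemF _).2 h, by rw [zdGraph_two_adj_iff]; simp⟩)
  -- the `-∗`semicircuit `x_n → (a, 1) → … → (b, 1) → y_n`
  have hA : zdStarGraph.Adj (![a, 0] : Site 2) ![a, 1] :=
    zdGraph_le_zdStarGraph (by rw [zdGraph_two_adj_iff]; simp)
  have hB : zdStarGraph.Adj (![b, 1] : Site 2) ![b, 0] :=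
    zdGraph_le_zdStarGraph (by rw [zdGraph_two_adj_iff]; simp)
  refine siteCluster_finite_of_oppStarWalk han hbn (Walk.cons hA (q.concat hB)) (fun z hz => ?_) hu
  rw [Walk.support_cons, List.mem_cons, Walk.support_concat, List.mem_append, List.mem_singleton] at hz
  rcases hz with rfl | hz | rfl
  · exact ⟨by simp, hxa, by simp; omega⟩
  · obtain ⟨hz1, hzF, hzω⟩ := hq z hz
    refine ⟨by omega, hzω, fun hband => hzF ((hmemF z).2 (hwin z ⟨hband.1, hband.2.1, hz1, hband.2.2⟩))⟩
  · exact ⟨by simp, hyb, by simp; omega⟩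

/-- The finite energy constant of two sites of `ℤ²` is at least `e^{-16|β|}/4`. [cite: GeorgiiHiguchi2000, Lemma 3.4 (proof, "`μ(A_N ∩ B) ≥ δ² μ(B)`")] -/
theorem exp_div_four_le_finiteEnergyConst_pair (β : ℝ) (x y : Site 2) :
    Real.exp (-(16 * |β|)) / 4 ≤
      Real.exp (-(2 * |β| * (#(edgesTouching (zdGraph 2) {x, y}) + |(0 : ℝ)| * #({x, y} : Finset (Site 2))))) /
        2 ^ #({x, y} : Finset (Site 2)) := by
  classical
  have hΛ : #({x, y} : Finset (Site 2)) ≤ 2 := Finset.card_le_two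
  have hcard : (#(edgesTouching (zdGraph 2) {x, y}) : ℝ) ≤ 8 := by
    have h1 : #(edgesTouching (zdGraph 2) {x, y}) ≤ ∑ z ∈ ({x, y} : Finset (Site 2)), #((zdGraph 2).incidenceFinset z) :=
      Finset.card_biUnion_le
    have h2 : ∑ z ∈ ({x, y} : Finset (Site 2)), #((zdGraph 2).incidenceFinset z) ≤ ∑ _z ∈ ({x, y} : Finset (Site 2)), 4 :=
      Finset.sum_le_sum fun z _ => card_incidenceFinset_zdGraph_le z
    rw [Finset.sum_const, smul_eq_mul] at h2
    have : #(edgesTouching (zdGraph 2) {x, y}) ≤ 8 := h1.trans (h2.trans (by omega))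
    exact_mod_cast this
  rw [abs_zero, zero_mul, add_zero]
  have hβ : 0 ≤ |β| := abs_nonneg β
  have hpow : (2 : ℝ) ^ #({x, y} : Finset (Site 2)) ≤ 4 := by
    calc (2 : ℝ) ^ #({x, y} : Finset (Site 2)) ≤ 2 ^ 2 := pow_le_pow_right₀ (by norm_num) hΛ
      _ = 4 := by norm_num
  have hpow_pos : 0 < (2 : ℝ) ^ #({x, y} : Finset (Site 2)) := pow_pos two_pos _
  calc Real.exp (-(16 * |β|)) / 4 ≤ Real.exp (-(2 * |β| * #(edgesTouching (zdGraph 2) {x, y}))) / 4 := by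
        refine div_le_div_of_nonneg_right (Real.exp_le_exp.2 ?_) (by norm_num)
        nlinarith
    _ ≤ Real.exp (-(2 * |β| * #(edgesTouching (zdGraph 2) {x, y}))) / 2 ^ #({x, y} : Finset (Site 2)) :=
        div_le_div_of_nonneg_left (Real.exp_pos _).le hpow_pos hpow

end Good

/-! ### Measurability of the facing event and of the good event -/

section Meas2

/-- The good event "every `+`cluster of `π_up` through `[-n, n] × [0, n+1]` is finite" is measurable. [folklore] -/
theorem measurableSet_windowGood (s : ℤˣ) (n : ℕ) :
    MeasurableSet {ω : SpinConfig (Site 2) | ∀ u : Site 2, (-(n : ℤ) ≤ u 0 ∧ u 0 ≤ n ∧ 0 ≤ u 1 ∧ u 1 ≤ (n : ℤ) + 1) →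
      (siteCluster (zdGraph 2) (spinSites s ω ∩ halfPlane 0) u).Finite} := by
  refine measurableSet_setOf.2 (Measurable.forall fun u => Measurable.imp measurable_const ?_)
  have h := (measurableSet_infinite_spinCluster s (halfPlane 0) u).compl
  rw [Set.compl_setOf] at h
  simp only [Set.not_infinite] at h
  exact measurableSet_setOf.1 h

/-- The facing event "`F_n(ω)` lies in a box and has facing abscissae `a, b`" is measurable. [folklore] -/
theorem measurableSet_facing (s : ℤˣ) (n : ℕ) (a b : ℤ) :
    MeasurableSet {ω : SpinConfig (Site 2) |
      (∀ t : ℤ, t ≤ a → (![t, 1] : Site 2) ∉ siteCluster (zdGraph 2) {v : Site 2 | (-(n : ℤ) ≤ v 0 ∧ v 0 ≤ n ∧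
        1 ≤ v 1 ∧ v 1 ≤ (n : ℤ) + 1) ∨ (ω v = s ∧ 1 ≤ v 1)} ![-(n : ℤ), 1]) ∧
      (∀ t : ℤ, t < a → (![t, 2] : Site 2) ∉ siteCluster (zdGraph 2) {v : Site 2 | (-(n : ℤ) ≤ v 0 ∧ v 0 ≤ n ∧
        1 ≤ v 1 ∧ v 1 ≤ (n : ℤ) + 1) ∨ (ω v = s ∧ 1 ≤ v 1)} ![-(n : ℤ), 1]) ∧
      ((![a + 1, 1] : Site 2) ∈ siteCluster (zdGraph 2) {v : Site 2 | (-(n : ℤ) ≤ v 0 ∧ v 0 ≤ n ∧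
        1 ≤ v 1 ∧ v 1 ≤ (n : ℤ) + 1) ∨ (ω v = s ∧ 1 ≤ v 1)} ![-(n : ℤ), 1] ∨
        (![a, 2] : Site 2) ∈ siteCluster (zdGraph 2) {v : Site 2 | (-(n : ℤ) ≤ v 0 ∧ v 0 ≤ n ∧
        1 ≤ v 1 ∧ v 1 ≤ (n : ℤ) + 1) ∨ (ω v = s ∧ 1 ≤ v 1)} ![-(n : ℤ), 1]) ∧
      (∀ t : ℤ, b ≤ t → (![t, 1] : Site 2) ∉ siteCluster (zdGraph 2) {v : Site 2 | (-(n : ℤ) ≤ v 0 ∧ v 0 ≤ n ∧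
        1 ≤ v 1 ∧ v 1 ≤ (n : ℤ) + 1) ∨ (ω v = s ∧ 1 ≤ v 1)} ![-(n : ℤ), 1]) ∧
      (∀ t : ℤ, b < t → (![t, 2] : Site 2) ∉ siteCluster (zdGraph 2) {v : Site 2 | (-(n : ℤ) ≤ v 0 ∧ v 0 ≤ n ∧
        1 ≤ v 1 ∧ v 1 ≤ (n : ℤ) + 1) ∨ (ω v = s ∧ 1 ≤ v 1)} ![-(n : ℤ), 1]) ∧
      ((![b - 1, 1] : Site 2) ∈ siteCluster (zdGraph 2) {v : Site 2 | (-(n : ℤ) ≤ v 0 ∧ v 0 ≤ n ∧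
        1 ≤ v 1 ∧ v 1 ≤ (n : ℤ) + 1) ∨ (ω v = s ∧ 1 ≤ v 1)} ![-(n : ℤ), 1] ∨
        (![b, 2] : Site 2) ∈ siteCluster (zdGraph 2) {v : Site 2 | (-(n : ℤ) ≤ v 0 ∧ v 0 ≤ n ∧
        1 ≤ v 1 ∧ v 1 ≤ (n : ℤ) + 1) ∨ (ω v = s ∧ 1 ≤ v 1)} ![-(n : ℤ), 1]) ∧
      (∃ B : ℕ, ∀ z : Site 2, z ∈ siteCluster (zdGraph 2) {v : Site 2 | (-(n : ℤ) ≤ v 0 ∧ v 0 ≤ n ∧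
        1 ≤ v 1 ∧ v 1 ≤ (n : ℤ) + 1) ∨ (ω v = s ∧ 1 ≤ v 1)} ![-(n : ℤ), 1] → z ∈ box 2 B)} := by
  have hm : ∀ z : Site 2, Measurable fun ω : SpinConfig (Site 2) => z ∈ siteCluster (zdGraph 2)
      {v : Site 2 | (-(n : ℤ) ≤ v 0 ∧ v 0 ≤ n ∧ 1 ≤ v 1 ∧ v 1 ≤ (n : ℤ) + 1) ∨ (ω v = s ∧ 1 ≤ v 1)} ![-(n : ℤ), 1] :=
    fun z => measurableSet_setOf.1 (measurableSet_mem_hull s n z)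
  refine measurableSet_setOf.2 ?_
  refine Measurable.and (Measurable.forall fun t => Measurable.imp measurable_const (hm _).not) ?_
  refine Measurable.and (Measurable.forall fun t => Measurable.imp measurable_const (hm _).not) ?_
  refine Measurable.and (Measurable.or (hm _) (hm _)) ?_
  refine Measurable.and (Measurable.forall fun t => Measurable.imp measurable_const (hm _).not) ?_
  refine Measurable.and (Measurable.forall fun t => Measurable.imp measurable_const (hm _).not) ?_
  refine Measurable.and (Measurable.or (hm _) (hm _)) ?_
  exact Measurable.exists fun B => Measurable.forall fun z => Measurable.imp (hm z) measurable_const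

end Meas2

/-! ### The finite-energy estimate and the shift lemma -/

section Main

variable {β : ℝ} {μ : Measure (SpinConfig (Site 2))}

/-- **Finite-energy estimate** (Georgii–Higuchi 2000, proof of Lemma 3.4: "`μ(A_N ∩ B_{N,x,y}) ≥
δ² μ(B_{N,x,y})` … summing over `x, y`"): if almost surely `π̃ = {x₂ ≥ 1}` contains no infinite
`+`cluster, then for every `n` the good event "no `+`cluster of `π_up` through `[-n, n] × [0, n+1]`
is infinite" has probability at least `e^{-16|β|}/4`. [cite: GeorgiiHiguchi2000, Lemma 3.4 (proof)] -/
theorem le_measure_windowGood (hμ : μ ∈ isingGibbsMeasures 2 β 0) (s : ℤˣ)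
    (hfin : ∀ᵐ ω ∂μ, ∀ p : Site 2, (siteCluster (zdGraph 2) (spinSites s ω ∩ halfPlane 1) p).Finite) (n : ℕ) :
    ENNReal.ofReal (Real.exp (-(16 * |β|)) / 4) ≤
      μ {ω : SpinConfig (Site 2) | ∀ u : Site 2, (-(n : ℤ) ≤ u 0 ∧ u 0 ≤ n ∧ 0 ≤ u 1 ∧ u 1 ≤ (n : ℤ) + 1) →
        (siteCluster (zdGraph 2) (spinSites s ω ∩ halfPlane 0) u).Finite} := by
  classical
  have hμG : IsGibbsMeasure (isingSpecification (zdGraph 2) β 0) μ := hμ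
  haveI := hμG.isProbabilityMeasure
  set δ₀ : ℝ≥0∞ := ENNReal.ofReal (Real.exp (-(16 * |β|)) / 4) with hδ₀
  set Good := {ω : SpinConfig (Site 2) | ∀ u : Site 2, (-(n : ℤ) ≤ u 0 ∧ u 0 ≤ n ∧ 0 ≤ u 1 ∧ u 1 ≤ (n : ℤ) + 1) →
    (siteCluster (zdGraph 2) (spinSites s ω ∩ halfPlane 0) u).Finite} with hGood
  -- the hull and the facing events
  set Hl : SpinConfig (Site 2) → Set (Site 2) := fun ω => siteCluster (zdGraph 2)
    {v : Site 2 | (-(n : ℤ) ≤ v 0 ∧ v 0 ≤ n ∧ 1 ≤ v 1 ∧ v 1 ≤ (n : ℤ) + 1) ∨ (ω v = s ∧ 1 ≤ v 1)} ![-(n : ℤ), 1]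
    with hHl
  set P : ℤ × ℤ → Set (SpinConfig (Site 2)) := fun ab => {ω |
      (∀ t : ℤ, t ≤ ab.1 → (![t, 1] : Site 2) ∉ Hl ω) ∧ (∀ t : ℤ, t < ab.1 → (![t, 2] : Site 2) ∉ Hl ω) ∧
      ((![ab.1 + 1, 1] : Site 2) ∈ Hl ω ∨ (![ab.1, 2] : Site 2) ∈ Hl ω) ∧
      (∀ t : ℤ, ab.2 ≤ t → (![t, 1] : Site 2) ∉ Hl ω) ∧ (∀ t : ℤ, ab.2 < t → (![t, 2] : Site 2) ∉ Hl ω) ∧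
      ((![ab.2 - 1, 1] : Site 2) ∈ Hl ω ∨ (![ab.2, 2] : Site 2) ∈ Hl ω) ∧
      (∃ B : ℕ, ∀ z : Site 2, z ∈ Hl ω → z ∈ box 2 B)} with hP
  have hPmeas : ∀ ab, MeasurableSet (P ab) := fun ab => measurableSet_facing s n ab.1 ab.2
  have hPdisj : Pairwise (Function.onFun Disjoint P) := by
    intro ab ab' hne
    rw [Function.onFun, Set.disjoint_left]
    rintro ω ⟨h0, h1, h2, h3, h4, h5, -⟩ ⟨h0', h1', h2', h3', h4', h5', -⟩
    exact hne (Prod.ext (leftFacing_unique h0 h1 h2 h0' h1' h2') (rightFacing_unique h3 h4 h5 h3' h4' h5'))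
  -- almost surely some facing event occurs
  have hcover : ∀ᵐ ω ∂μ, ∃ ab, ω ∈ P ab := by
    filter_upwards [hfin] with ω hω
    have hHfin : (Hl ω).Finite := by
      have hsub : Hl ω ⊆ {z : Site 2 | -(n : ℤ) ≤ z 0 ∧ z 0 ≤ n ∧ 1 ≤ z 1 ∧ z 1 ≤ (n : ℤ) + 1} ∪
          ⋃ p ∈ (box 2 (n + 2) : Finset (Site 2)), siteCluster (zdGraph 2) (spinSites s ω ∩ halfPlane 1) p := by
        intro z hz
        by_cases hzw : -(n : ℤ) ≤ z 0 ∧ z 0 ≤ n ∧ 1 ≤ z 1 ∧ z 1 ≤ (n : ℤ) + 1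
        · exact Or.inl hzw
        · obtain ⟨p, hp, hzp⟩ := exists_mem_siteCluster_of_mem_hull (P := spinSites s ω ∩ halfPlane 1)
            (fun v hv => by
              rcases hv with hv | ⟨hv, hv1⟩
              · exact Or.inl hv
              · exact Or.inr ⟨hv, hv1⟩) hz hzw
          exact Or.inr (Set.mem_biUnion hp hzp)
      refine Set.Finite.subset (Set.Finite.union ?_ (Set.Finite.biUnion (box 2 (n + 2)).finite_toSet
        fun p _ => hω p)) hsub
      refine ((box 2 (n + 1) : Finset (Site 2)).finite_toSet).subset fun z hz => ?_
      have hz' : -(n : ℤ) ≤ z 0 ∧ z 0 ≤ n ∧ 1 ≤ z 1 ∧ z 1 ≤ (n : ℤ) + 1 := hz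
      rw [Finset.mem_coe, mem_box, Fin.forall_fin_two]; push_cast; omega
    set F := hHfin.toFinset with hF
    have hmemF : ∀ z, z ∈ F ↔ z ∈ Hl ω := fun z => Set.Finite.mem_toFinset hHfin
    have hwin : ∀ z : Site 2, (-(n : ℤ) ≤ z 0 ∧ z 0 ≤ n ∧ 1 ≤ z 1 ∧ z 1 ≤ (n : ℤ) + 1) → z ∈ Hl ω :=
      fun z hz => mem_siteCluster_corner_of_window (fun v hv => Or.inl hv) hz
    obtain ⟨a, ha0, ha1, ha2⟩ := exists_leftFacing F ⟨-(n : ℤ) - 1, Or.inl ((hmemF _).2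
      (by rw [sub_add_cancel]; exact hwin _ ⟨by simp, by simp, by simp, by simp⟩))⟩
    obtain ⟨b, hb0, hb1, hb2⟩ := exists_rightFacing F ⟨(n : ℤ) + 1, Or.inl ((hmemF _).2
      (by rw [add_sub_cancel_right]; exact hwin _ ⟨by simp, by simp, by simp, by simp⟩))⟩
    obtain ⟨B, hB⟩ := (eventually_subset_box_holds (d := 2) F).exists
    refine ⟨(a, b), fun t ht h => ha0 t ht ((hmemF _).2 h), fun t ht h => ha1 t ht ((hmemF _).2 h),
      ha2.imp (hmemF _).1 (hmemF _).1, fun t ht h => hb0 t ht ((hmemF _).2 h),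
      fun t ht h => hb1 t ht ((hmemF _).2 h), hb2.imp (hmemF _).1 (hmemF _).1,
      B, fun z hz => hB ((hmemF z).2 hz)⟩
  -- finite energy on each facing event
  have hstep : ∀ ab, δ₀ * μ (P ab) ≤ μ (Good ∩ P ab) := by
    rintro ⟨a, b⟩
    set Λ : Finset (Site 2) := {![a, 0], ![b, 0]} with hΛ
    have key := hμG.mul_measure_glueWith_preimage_le (G := zdGraph 2) Λ (fun _ => (-s))
      ((measurableSet_windowGood s n).inter (hPmeas (a, b)))
    have hsub : P (a, b) ⊆ {η | glueWith Λ (fun _ => (-s)) η ∈ Good ∩ P (a, b)} := by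
      intro η hη
      set η' := glueWith Λ (fun _ => (-s)) η with hη'
      have heq : ∀ v : Site 2, 1 ≤ v 1 → η' v = η v := by
        intro v hv
        rw [hη', glueWith_apply_not_mem]
        rw [hΛ, Finset.mem_insert, Finset.mem_singleton]
        rintro (rfl | rfl) <;> simp at hv
      have hHl_eq : Hl η' = Hl η := hull_eq_of_eqOn_upper s n heq
      have hη'P : η' ∈ P (a, b) := by
        show (∀ t : ℤ, t ≤ a → (![t, 1] : Site 2) ∉ Hl η') ∧ _
        rw [hHl_eq]; exact hη
      have hcopy := hη'P
      obtain ⟨h0, h1, h2, h3, h4, h5, B, hB⟩ := hcopy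
      refine ⟨fun u hu => ?_, hη'P⟩
      have hxa : η' ![a, 0] = -s := by
        rw [hη', glueWith_apply_mem]; rw [hΛ]; simp
      have hyb : η' ![b, 0] = -s := by
        rw [hη', glueWith_apply_mem]; rw [hΛ]; simp
      exact siteCluster_finite_of_facing (((box 2 B : Finset (Site 2)).finite_toSet).subset fun z hz => hB z hz)
        h0 h1 h2 h3 h4 h5 hxa hyb hu
    calc δ₀ * μ (P (a, b))
        ≤ ENNReal.ofReal (Real.exp (-(2 * |β| * (#(edgesTouching (zdGraph 2) Λ) + |(0 : ℝ)| * #Λ))) / 2 ^ #Λ) *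
            μ {η | glueWith Λ (fun _ => (-s)) η ∈ Good ∩ P (a, b)} :=
          mul_le_mul' (ENNReal.ofReal_le_ofReal (exp_div_four_le_finiteEnergyConst_pair β _ _)) (measure_mono hsub)
      _ ≤ μ (Good ∩ P (a, b)) := key
  -- summing over the facing events
  have hunion : μ (⋃ ab, P ab) = 1 := by
    rw [← prob_compl_eq_zero_iff (MeasurableSet.iUnion hPmeas), measure_eq_zero_iff_ae_notMem]
    filter_upwards [hcover] with ω hω h
    exact h (Set.mem_iUnion.2 hω)
  calc δ₀ = δ₀ * μ (⋃ ab, P ab) := by rw [hunion, mul_one]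
    _ = ∑' ab, δ₀ * μ (P ab) := by rw [measure_iUnion hPdisj hPmeas, ENNReal.tsum_mul_left]
    _ ≤ ∑' ab, μ (Good ∩ P ab) := ENNReal.tsum_le_tsum hstep
    _ = μ (⋃ ab, Good ∩ P ab) := by
        rw [measure_iUnion (fun ab ab' hne => (hPdisj hne).mono Set.inter_subset_right Set.inter_subset_right)
          fun ab => (measurableSet_windowGood s n).inter (hPmeas ab)]
    _ ≤ μ Good := measure_mono (Set.iUnion_subset fun ab => Set.inter_subset_left)

/-- **Shift lemma** (Georgii–Higuchi 2000, Lemma 3.4) for the upper half-plane and a tail-trivial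
Gibbs measure: if `π_up = {x₂ ≥ 0}` almost surely contains an infinite `+`cluster, then so does
the shrunk half-plane `π̃ = {x₂ ≥ 1}`. [cite: GeorgiiHiguchi2000, Lemma 3.4] -/
theorem shift_lemma_up (hμ : μ ∈ isingGibbsMeasures 2 β 0) (hμt : IsTailTrivial μ) (s : ℤˣ)
    (h : ∀ᵐ ω ∂μ, ∃ x, (siteCluster (zdGraph 2) (spinSites s ω ∩ halfPlane 0) x).Infinite) :
    ∀ᵐ ω ∂μ, ∃ x, (siteCluster (zdGraph 2) (spinSites s ω ∩ halfPlane 1) x).Infinite := by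
  classical
  have hμG : IsGibbsMeasure (isingSpecification (zdGraph 2) β 0) μ := hμ
  haveI := hμG.isProbabilityMeasure
  rcases hμt.measure_existsInfClusterIn (G := zdGraph 2) s (halfPlane 1) with h0 | h1
  · exfalso
    have hfin : ∀ᵐ ω ∂μ, ∀ p : Site 2, (siteCluster (zdGraph 2) (spinSites s ω ∩ halfPlane 1) p).Finite := by
      filter_upwards [measure_eq_zero_iff_ae_notMem.1 h0] with ω hω p
      by_contra hinf
      exact hω ⟨p, Set.not_finite.1 hinf⟩
    set Good : ℕ → Set (SpinConfig (Site 2)) := fun n => {ω | ∀ u : Site 2,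
      (-(n : ℤ) ≤ u 0 ∧ u 0 ≤ n ∧ 0 ≤ u 1 ∧ u 1 ≤ (n : ℤ) + 1) →
        (siteCluster (zdGraph 2) (spinSites s ω ∩ halfPlane 0) u).Finite} with hGood
    have hanti : Antitone Good := by
      intro n m hnm ω hω u hu
      have : (n : ℤ) ≤ m := by exact_mod_cast hnm
      exact hω u ⟨by omega, by omega, hu.2.2.1, by omega⟩
    have hlim := tendsto_measure_iInter_atTop (μ := μ) (fun n => (measurableSet_windowGood s n).nullMeasurableSet)
      hanti ⟨0, measure_ne_top μ _⟩
    have hge : ENNReal.ofReal (Real.exp (-(16 * |β|)) / 4) ≤ μ (⋂ n, Good n) :=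
      ge_of_tendsto' hlim fun n => le_measure_windowGood hμ s hfin n
    have hnull : μ (⋂ n, Good n) = 0 := by
      rw [measure_eq_zero_iff_ae_notMem]
      filter_upwards [h] with ω hω hmem
      obtain ⟨x, hx⟩ := hω
      rw [Set.mem_iInter] at hmem
      have hxO : x ∈ spinSites s ω ∩ halfPlane 0 := by
        obtain ⟨y, hy⟩ := hx.nonempty
        exact hy.1
      have hx1 : 0 ≤ x 1 := hxO.2
      set N : ℕ := max (x 0).natAbs (x 1).natAbs with hN
      have h0 : ((x 0).natAbs : ℤ) ≤ N := by exact_mod_cast le_max_left _ _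
      have h1 : ((x 1).natAbs : ℤ) ≤ N := by exact_mod_cast le_max_right _ _
      exact hx (hmem N x ⟨by omega, by omega, hx1, by omega⟩)
    rw [hnull, nonpos_iff_eq_zero, ENNReal.ofReal_eq_zero] at hge
    exact absurd hge (not_le.2 (div_pos (Real.exp_pos _) four_pos))
  · have hE : MeasurableSet (existsInfClusterIn (zdGraph 2) s (halfPlane 1) : Set (SpinConfig (Site 2))) :=
      tailEvents_le_pi _ (measurableSet_tailEvents_existsInfClusterIn (G := zdGraph 2) s (halfPlane 1))
    have := (prob_compl_eq_zero_iff hE).2 h1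
    rw [measure_eq_zero_iff_ae_notMem] at this
    filter_upwards [this] with ω hω
    by_contra hne
    exact hω (fun hmem => hne hmem)

end Main

/-! ### Iterating: all levels -/

section Level

variable {β : ℝ} {μ : Measure (SpinConfig (Site 2))}

/-- Shifting a configuration down by `e₂` turns the `s`-clusters of `{x₂ ≥ k + 1}` into those of
`{x₂ ≥ k}`. [folklore] -/
theorem exists_infinite_cluster_configShift_down_iff (s : ℤˣ) (k : ℤ) (ω : SpinConfig (Site 2)) :
    (∃ y, (siteCluster (zdGraph 2) (spinSites s (configShift (-(Pi.single 1 1 : Site 2)) ω) ∩ halfPlane k) y).Infinite) ↔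
      ∃ y, (siteCluster (zdGraph 2) (spinSites s ω ∩ halfPlane (k + 1)) y).Infinite := by
  set φ := zdShiftIso (d := 2) (-(Pi.single 1 1 : Site 2)) with hφ
  have hcfg : (configShift (S := ℤˣ) (-(Pi.single 1 1 : Site 2)) ω : SpinConfig (Site 2)) =
      configRelabel φ.toEquiv ω := rfl
  have himg : (φ : Site 2 → Site 2) '' (spinSites s ω ∩ halfPlane (k + 1)) =
      (φ : Site 2 → Site 2) '' spinSites s ω ∩ halfPlane k := by
    ext z
    simp only [Set.mem_image, Set.mem_inter_iff, halfPlane, Set.mem_setOf_eq, hφ, zdShiftIso_apply]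
    constructor
    · rintro ⟨y, ⟨hy, hy1⟩, rfl⟩
      exact ⟨⟨y, hy, rfl⟩, by simp; omega⟩
    · rintro ⟨⟨y, hy, rfl⟩, hz1⟩
      refine ⟨y, ⟨hy, ?_⟩, rfl⟩
      simp at hz1; omega
  have hO : spinSites s (configShift (S := ℤˣ) (-(Pi.single 1 1 : Site 2)) ω) ∩ halfPlane k =
      (φ : Site 2 → Site 2) '' (spinSites s ω ∩ halfPlane (k + 1)) := by
    rw [hcfg, spinSites_configRelabel, himg]; rfl
  have key : ∀ y : Site 2, siteCluster (zdGraph 2) ((φ : Site 2 → Site 2) '' (spinSites s ω ∩ halfPlane (k + 1))) (φ y) =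
      (φ : Site 2 → Site 2) '' siteCluster (zdGraph 2) (spinSites s ω ∩ halfPlane (k + 1)) y := fun y => by
    have h := siteCluster_relabel φ (spinSites s ω ∩ halfPlane (k + 1)) y
    rwa [SiteConfig.relabel_apply] at h
  rw [hO]
  constructor
  · rintro ⟨y, hy⟩
    refine ⟨φ.symm y, ?_⟩
    have hk := key (φ.symm y)
    rw [RelIso.apply_symm_apply] at hk
    rw [hk] at hy
    exact Set.Infinite.of_image _ hy
  · rintro ⟨y, hy⟩
    exact ⟨φ y, by rw [key]; exact hy.image φ.injective.injOn⟩

/-- **Shift lemma, all levels** (Georgii–Higuchi 2000, Lemma 3.4, iterated): for tail-trivial `μ ∈ 𝒢`,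
if `π_up` almost surely contains an infinite `s`-cluster then so does `{x₂ ≥ L}` for every `L`. [cite: GeorgiiHiguchi2000, Lemma 3.4] -/
theorem shift_lemma_up_level (hμ : μ ∈ isingGibbsMeasures 2 β 0) (hμt : IsTailTrivial μ) (s : ℤˣ)
    (h : ∀ᵐ ω ∂μ, ∃ x, (siteCluster (zdGraph 2) (spinSites s ω ∩ halfPlane 0) x).Infinite) (L : ℕ) :
    ∀ᵐ ω ∂μ, ∃ x, (siteCluster (zdGraph 2) (spinSites s ω ∩ halfPlane L) x).Infinite := by
  classical
  induction L generalizing μ with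
  | zero => simpa using h
  | succ L ih =>
    have hmeas : ∀ k : ℤ, MeasurableSet {ω : SpinConfig (Site 2) | ∃ x,
        (siteCluster (zdGraph 2) (spinSites s ω ∩ halfPlane k) x).Infinite} := fun k =>
      MeasurableSet.of_tailEvents (measurableSet_tailEvents_existsInfClusterIn (G := zdGraph 2) s (halfPlane k))
    have h1 := shift_lemma_up hμ hμt s h
    have hμ' : μ.map (configShift (-(Pi.single 1 1 : Site 2))) ∈ isingGibbsMeasures 2 β 0 :=
      mem_isingGibbsMeasures_map_configShift hμ _
    have hμ't : IsTailTrivial (μ.map (configShift (-(Pi.single 1 1 : Site 2)))) := by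
      rw [configShift_eq_configRelabel]; exact hμt.map_configRelabel _
    have h0' : ∀ᵐ ω ∂(μ.map (configShift (-(Pi.single 1 1 : Site 2)))), ∃ x,
        (siteCluster (zdGraph 2) (spinSites s ω ∩ halfPlane 0) x).Infinite := by
      rw [ae_map_iff (configShift _).measurable.aemeasurable (hmeas 0)]
      filter_upwards [h1] with ω hω
      exact (exists_infinite_cluster_configShift_down_iff s 0 ω).2 (by simpa using hω)
    have hL' := ih hμ' hμ't h0'
    rw [ae_map_iff (configShift _).measurable.aemeasurable (hmeas L)] at hL'
    filter_upwards [hL'] with ω hω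
    have := (exists_infinite_cluster_configShift_down_iff s L ω).1 hω
    push_cast
    exact this

end Level

end Literature.Probability.LatticeModels
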